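import Summits.AtomisticToContinuum.FouriersLaw.Theorems.BondHeatUncertaintyLinearResponseFTURK3Setting
import Summits.AtomisticToContinuum.FouriersLaw.Theorems.BondHeatUncertaintyLinearResponseFTURLimitIdentification

/-!
# The limits of the discrete log-densities and of the scheme observables (K3 helper)

Helper file for stub `stub_antiDampedGirsanov` (K3) of line `lebesgue-flip-duality`, crux ★
`BondHeatUncertainty.LinearResponseFTUR` (stmt-AtomisticToContinuum-9122); sequel of `…K3Setting.lean`.

* `logW … ε σ m y w` — the exponent of the density ratio of the reweighting identities of
  `…DiscreteIdentity.lean` for the dyadic scheme of signs `(ε, σ)` and mesh `t/2^m`;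
  `logW_eq` — its expression through the Itô / Riemann sums of the clamped bath momenta at the
  scheme nodes (`itoPiece`, `riemPiece`);
* `tendsto_logW_damped` — along the DAMPED schemes, on the event that the bath momenta of the forward
  path `X` stay in `[-(R-1), R-1]` and the dyadic quadratic variations of the two Brownian coordinates
  converge, `logW 1 1 m → Q_L(X)/T_L + Q_R(X)/T_R - 2γt`;
  `tendsto_logW_anti` — along the ANTI-damped schemes, towards `-(Q_L(Z)/T_L + Q_R(Z)/T_R) + 2γt`;
* `tendsto_rawObs_of_unif` — the raw observables of uniformly convergent paths converge.
-/

noncomputable section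

namespace Summit.AtomisticToContinuum.FouriersLaw.Theorems.LinearResponseFTUR

open MeasureTheory Filter Set Function Finset intervalIntegral Topology Metric
open scoped NNReal ENNReal
open Literature.MathematicalPhysics.KineticTheory
open Literature.MathematicalPhysics.KineticTheory.HeatConduction
open Literature.Probability.Process
open Literature.Analysis.ODE
open Summit.AtomisticToContinuum.FouriersLaw.Theorems.BondHeatUncertainty
open Summit.AtomisticToContinuum.FouriersLaw.Theorems.SubdiffusiveBondHeat

variable {N : ℕ}

/-! ### The pieces -/

/-- The Itô sum of the clamped bath momentum `p_b` at the nodes of the paths `z_m` against `B`. -/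
def itoPiece (t R : ℝ) (b : Fin N) (z : ℕ → ℝ → PhaseSpace N) (B : ℝ → ℝ) (m : ℕ) : ℝ :=
  ∑ k ∈ range (2 ^ m), clampR R ((z m ((k : ℝ) * (t / 2 ^ m))).2 b) *
    (B (((k : ℝ) + 1) * (t / 2 ^ m)) - B ((k : ℝ) * (t / 2 ^ m)))

/-- The Riemann sum of the squared clamped bath momentum at the nodes. -/
def riemPiece (t R : ℝ) (b : Fin N) (z : ℕ → ℝ → PhaseSpace N) (m : ℕ) : ℝ :=
  ∑ k ∈ range (2 ^ m), t / 2 ^ m * clampR R ((z m ((k : ℝ) * (t / 2 ^ m))).2 b) ^ 2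

/-- The exponent of the density ratio of the reweighting identity for the dyadic scheme of signs
`(ε, σ)` (`(1,1)`: the inverse shift `U`, predictable w.r.t. the damped states; `(-1,-1)`: the shift `S`). -/
def logW (ω₂ lam β γ : ℝ) (N : ℕ) (T_L T_R R t ε σ : ℝ) (m : ℕ) (y : PhaseSpace N) (w : WienerPair) : ℝ :=
  ∑ k : Fin (2 ^ m),
    ((2 * ((dyScheme ω₂ lam β γ N T_L T_R R t m).shiftPart ε σ (2 ^ m) y (pairGridIncr (2 ^ m) (t / 2 ^ m) w) k).1 *
          (pairGridIncr (2 ^ m) (t / 2 ^ m) w k).1 -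
        ((dyScheme ω₂ lam β γ N T_L T_R R t m).shiftPart ε σ (2 ^ m) y (pairGridIncr (2 ^ m) (t / 2 ^ m) w) k).1 ^ 2) +
      (2 * ((dyScheme ω₂ lam β γ N T_L T_R R t m).shiftPart ε σ (2 ^ m) y (pairGridIncr (2 ^ m) (t / 2 ^ m) w) k).2 *
          (pairGridIncr (2 ^ m) (t / 2 ^ m) w k).2 -
        ((dyScheme ω₂ lam β γ N T_L T_R R t m).shiftPart ε σ (2 ^ m) y (pairGridIncr (2 ^ m) (t / 2 ^ m) w) k).2 ^ 2)) /
      (2 * (dyScheme ω₂ lam β γ N T_L T_R R t m).h)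

/-- The heat functional `W = Q_L/T_L + Q_R/T_R` on the observable space. -/
def heatFunctional (T_L T_R : ℝ) (i0 iN : Fin N) (p : Obs N) : ℝ := leftHeat i0 p / T_L + rightHeat iN p / T_R

/-- `leftMom` at `N ≥ 2` reads the coordinate `i0`. -/
theorem leftMom_eq (hN : 2 ≤ N) (i0 : Fin N) (hi0 : i0.val = 0) (z : PhaseSpace N) : leftMom N z = z.2 i0 := by
  have hN0 : 0 < N := by omega
  have e : (⟨0, hN0⟩ : Fin N) = i0 := Fin.ext (by simp [hi0])
  simp only [leftMom, dif_pos hN0, e]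

/-- `rightMom` at `N ≥ 2` reads the coordinate `iN`. -/
theorem rightMom_eq (hN : 2 ≤ N) (iN : Fin N) (hiN : iN.val = N - 1) (z : PhaseSpace N) : rightMom N z = z.2 iN := by
  have hN0 : 0 < N := by omega
  have e : (⟨N - 1, by omega⟩ : Fin N) = iN := Fin.ext (by simp [hiN])
  simp only [rightMom, dif_pos hN0, e]

/-- The `b` component of the frictionless drift is continuous. -/
theorem continuous_drift_snd {ω₂ lam β : ℝ} (hω : 0 < ω₂) (hl : 0 ≤ lam) (hβ : 0 ≤ β) (N : ℕ) (b : Fin N) :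
    Continuous fun z : PhaseSpace N => ((pinnedChain ω₂ lam β 0).drift N z).2 b :=
  (continuous_apply b).comp (continuous_snd.comp (frictionless hω hl hβ N).contDiff_drift.continuous)

/-- The momentum component of the frictionless drift is minus the force: `Y₀(z)_b = -∂_{q_b} H(z)`. -/
theorem drift_snd_eq (ω₂ lam β γ : ℝ) (N : ℕ) (b : Fin N) (z : PhaseSpace N) :
    ((pinnedChain ω₂ lam β 0).drift N z).2 b = -partialQ b ((pinnedChain ω₂ lam β γ).hamiltonian N) z := by
  show -partialQ b ((pinnedChain ω₂ lam β 0).hamiltonian N) z - (0 : ℝ) * OscillatorChain.bathWeight N b * z.2 b = _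
  rw [pinnedChain_hamiltonian_eq ω₂ lam β γ]
  ring

/-- `∫₀ᵗ p_b Y₀(X)_b = -I_b(X)`. -/
theorem integral_mul_drift_snd_eq (ω₂ lam β γ : ℝ) (N : ℕ) (b : Fin N) (t : ℝ) (X : ℝ → PhaseSpace N) :
    ∫ u in (0 : ℝ)..t, (X u).2 b * ((pinnedChain ω₂ lam β 0).drift N (X u)).2 b =
      -workIntegral (pinnedChain ω₂ lam β γ) N b t X := by
  unfold workIntegral
  rw [← intervalIntegral.integral_neg]
  refine intervalIntegral.integral_congr fun u _ => ?_
  simp only [drift_snd_eq ω₂ lam β γ]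
  ring

section Main

variable {ω₂ lam β γ : ℝ} (hω : 0 < ω₂) (hl : 0 < lam) (hβ : 0 < β) (hγ : 0 < γ) (hN : 2 ≤ N)
  (i0 iN ib : Fin N) (hi0 : i0.val = 0) (hiN : iN.val = N - 1) {T_L T_R : ℝ} (hTL : 0 < T_L) (hTR : 0 < T_R)
  {t : ℝ} (ht : 0 < t) (R : ℝ) (y : PhaseSpace N) (w : WienerPair)

include hω hl hβ hγ hN hi0 hiN hTL hTR ht

/-- **The exponent through the node sums**: for `(ε, σ)` and every `m`,
`logW = (2γ/c_L)·ito_L - (2γ²/c_L²)·riem_L + (2γ/c_R)·ito_R - (2γ²/c_R²)·riem_R` along the scheme paths. -/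
theorem logW_eq (ε σ : ℝ) (m : ℕ) :
    logW ω₂ lam β γ N T_L T_R R t ε σ m y w =
      2 * γ / bathAmp γ T_L * itoPiece t R i0 (fun m => schemePath ω₂ lam β γ N T_L T_R R t ε σ m y w) (bm1 w) m -
        2 * γ ^ 2 / bathAmp γ T_L ^ 2 * riemPiece t R i0 (fun m => schemePath ω₂ lam β γ N T_L T_R R t ε σ m y w) m +
      (2 * γ / bathAmp γ T_R * itoPiece t R iN (fun m => schemePath ω₂ lam β γ N T_L T_R R t ε σ m y w) (bm2 w) m -
        2 * γ ^ 2 / bathAmp γ T_R ^ 2 * riemPiece t R iN (fun m => schemePath ω₂ lam β γ N T_L T_R R t ε σ m y w) m) := by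
  have hcL := bathAmp_pos hγ hTL
  have hcR := bathAmp_pos hγ hTR
  have hh : (0 : ℝ) < t / 2 ^ m := by positivity
  set D := dyScheme ω₂ lam β γ N T_L T_R R t m with hD
  have hDh : D.h = t / 2 ^ m := rfl
  -- the summand as a function of `k : ℕ`
  set F : ℕ → ℝ := fun k =>
    2 * γ / bathAmp γ T_L * (clampR R ((schemePath ω₂ lam β γ N T_L T_R R t ε σ m y w ((k : ℝ) * (t / 2 ^ m))).2 i0) *
        (bm1 w (((k : ℝ) + 1) * (t / 2 ^ m)) - bm1 w ((k : ℝ) * (t / 2 ^ m)))) -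
      2 * γ ^ 2 / bathAmp γ T_L ^ 2 * (t / 2 ^ m *
        clampR R ((schemePath ω₂ lam β γ N T_L T_R R t ε σ m y w ((k : ℝ) * (t / 2 ^ m))).2 i0) ^ 2) +
      (2 * γ / bathAmp γ T_R * (clampR R ((schemePath ω₂ lam β γ N T_L T_R R t ε σ m y w ((k : ℝ) * (t / 2 ^ m))).2 iN) *
        (bm2 w (((k : ℝ) + 1) * (t / 2 ^ m)) - bm2 w ((k : ℝ) * (t / 2 ^ m)))) -
      2 * γ ^ 2 / bathAmp γ T_R ^ 2 * (t / 2 ^ m *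
        clampR R ((schemePath ω₂ lam β γ N T_L T_R R t ε σ m y w ((k : ℝ) * (t / 2 ^ m))).2 iN) ^ 2)) with hF
  have hterm : ∀ k : Fin (2 ^ m),
      ((2 * (D.shiftPart ε σ (2 ^ m) y (pairGridIncr (2 ^ m) (t / 2 ^ m) w) k).1 *
            (pairGridIncr (2 ^ m) (t / 2 ^ m) w k).1 -
          (D.shiftPart ε σ (2 ^ m) y (pairGridIncr (2 ^ m) (t / 2 ^ m) w) k).1 ^ 2) +
        (2 * (D.shiftPart ε σ (2 ^ m) y (pairGridIncr (2 ^ m) (t / 2 ^ m) w) k).2 *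
            (pairGridIncr (2 ^ m) (t / 2 ^ m) w k).2 -
          (D.shiftPart ε σ (2 ^ m) y (pairGridIncr (2 ^ m) (t / 2 ^ m) w) k).2 ^ 2)) / (2 * D.h) = F k := by
    intro k
    have hk : (k : ℕ) < 2 ^ m := k.2
    -- the states at the nodes are the scheme path
    have hstate : D.state ε σ y (extIncr (2 ^ m) (pairGridIncr (2 ^ m) (t / 2 ^ m) w)) k =
        schemePath ω₂ lam β γ N T_L T_R R t ε σ m y w ((k : ℝ) * (t / 2 ^ m)) := by
      have := SchemeData.path_grid (D := D) (ε := ε) (σ := σ) (y := y) (x := incrs t m w) (M := 2 ^ m)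
        (frictionless hω hl.le hβ.le N) rfl (by rw [hDh]; exact hh) hk.le
      rw [hDh] at this
      exact this.symm
    have hξ : pairGridIncr (2 ^ m) (t / 2 ^ m) w k = incrs t m w k := (extIncr_apply_fin _ k).symm
    simp only [SchemeData.shiftPart, hstate, leftMom_eq hN i0 hi0, rightMom_eq hN iN hiN, hξ, incrs_apply hk, hDh, hF]
    rw [show D.γ = γ from rfl, show D.R = R from rfl, show D.cL = bathAmp γ T_L from rfl,
      show D.cR = bathAmp γ T_R from rfl]
    field_simp
  unfold logW
  rw [Finset.sum_congr rfl fun k _ => hterm k, Fin.sum_univ_eq_sum_range F (2 ^ m)]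
  simp only [hF, itoPiece, riemPiece, Finset.sum_add_distrib, Finset.sum_sub_distrib, Finset.mul_sum]

/-- **The log-density along the damped schemes converges to `W(X) - 2γt`.** -/
theorem tendsto_logW_damped
    (hgood : ∀ s ∈ Icc 0 t, |(fwdPath (pinnedChain ω₂ lam β γ) N T_L T_R y w s).2 i0| ≤ R - 1 ∧
      |(fwdPath (pinnedChain ω₂ lam β γ) N T_L T_R y w s).2 iN| ≤ R - 1)
    (hQV1 : Tendsto (fun m : ℕ => ∑ k ∈ range (2 ^ m),
      (bm1 w (((k : ℝ) + 1) * (t / 2 ^ m)) - bm1 w ((k : ℝ) * (t / 2 ^ m))) ^ 2) atTop (𝓝 t))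
    (hQV2 : Tendsto (fun m : ℕ => ∑ k ∈ range (2 ^ m),
      (bm2 w (((k : ℝ) + 1) * (t / 2 ^ m)) - bm2 w ((k : ℝ) * (t / 2 ^ m))) ^ 2) atTop (𝓝 t)) :
    Tendsto (fun m : ℕ => logW ω₂ lam β γ N T_L T_R R t 1 1 m y w) atTop
      (𝓝 (heatFunctional T_L T_R i0 iN (rawObs (pinnedChain ω₂ lam β γ) N i0 iN ib t y
        (fwdPath (pinnedChain ω₂ lam β γ) N T_L T_R y w)) - 2 * γ * t)) := by
  set X := fwdPath (pinnedChain ω₂ lam β γ) N T_L T_R y w with hX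
  set z : ℕ → ℝ → PhaseSpace N := fun m => schemePath ω₂ lam β γ N T_L T_R R t 1 1 m y w with hz
  have hR1 : 1 ≤ R := by have := (abs_nonneg _).trans (hgood 0 ⟨le_rfl, ht.le⟩).1; linarith
  have hXc : Continuous X := continuous_fwdPath hω hl.le hβ.le hγ.le N T_L T_R y w
  have hzc : ∀ m, Continuous (z m) := fun m => continuous_schemePath hω hl.le hβ.le γ N T_L T_R R t 1 1 m y w
  have hXR : ∀ s ∈ Icc 0 t, |leftMom N (X s)| ≤ R ∧ |rightMom N (X s)| ≤ R := fun s hs => by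
    rw [leftMom_eq hN i0 hi0, rightMom_eq hN iN hiN]
    exact ⟨(hgood s hs).1.trans (by linarith), (hgood s hs).2.trans (by linarith)⟩
  have hconv : ∀ η : ℝ, 0 < η → ∀ᶠ m : ℕ in atTop, ∀ s ∈ Icc 0 t, ‖z m s - X s‖ ≤ η :=
    tendsto_schemePath_fwd hω hl.le hβ.le hγ.le N T_L T_R ht (by linarith) y w hXR
  have hXL : ∀ s ∈ Icc 0 t, |(X s).2 i0| ≤ R - 1 := fun s hs => (hgood s hs).1
  have hXRt : ∀ s ∈ Icc 0 t, |(X s).2 iN| ≤ R - 1 := fun s hs => (hgood s hs).2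
  -- the integral equation and its bath components
  have hXeq : ∀ s ∈ Icc 0 t, X s = y + ((1 : ℝ) • noiseImpulse N (bathAmp γ T_L) (bathAmp γ T_R) (bm1 w s, bm2 w s) -
      (1 * γ) • ∫ u in (0 : ℝ)..s, frictionVec N (X u)) + ∫ u in (0 : ℝ)..s, (pinnedChain ω₂ lam β 0).drift N (X u) := by
    intro s hs
    have h := fwdPath_integralEq hω hl.le hβ.le hγ.le N T_L T_R y w t s hs
    rw [chainPairNoise_eq] at h
    exact h
  have hY₀c := (frictionless hω hl.le hβ.le N).contDiff_drift.continuous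
  have hXbL := snd_bath_of_integralEq hY₀c hXc hXeq i0 (bathWeight_left hN i0 hi0)
    (fun s => noiseImpulse_snd_left hN i0 hi0 _ _ _)
  have hXbR := snd_bath_of_integralEq hY₀c hXc hXeq iN (bathWeight_right hN iN hiN)
    (fun s => noiseImpulse_snd_right hN iN hiN _ _ _)
  -- the four limits
  have hitoL := tendsto_ito_clamp ht i0 hXc hconv hXL (continuous_bm1 w) (bm1_zero w)
    (continuous_drift_snd hω hl.le hβ.le N i0) (ε := 1) (σ := 1) (γ := γ)
    (by rw [one_mul]; exact (bathAmp_pos hγ hTL).ne') y hzc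
    (fun m k hk => by
      have h := dyadic_node_left (frictionless hω hl.le hβ.le N) rfl ht hN γ R (bathAmp γ T_L) (bathAmp γ T_R)
        1 1 y (fun m => incrs t m w) i0 hi0 m k hk
      rw [incrs_apply hk] at h
      exact h) hXbL hQV1
  have hitoR := tendsto_ito_clamp ht iN hXc hconv hXRt (continuous_bm2 w) (bm2_zero w)
    (continuous_drift_snd hω hl.le hβ.le N iN) (ε := 1) (σ := 1) (γ := γ)
    (by rw [one_mul]; exact (bathAmp_pos hγ hTR).ne') y hzc
    (fun m k hk => by
      have h := dyadic_node_right (frictionless hω hl.le hβ.le N) rfl ht hN γ R (bathAmp γ T_L) (bathAmp γ T_R)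
        1 1 y (fun m => incrs t m w) iN hiN m k hk
      rw [incrs_apply hk] at h
      exact h) hXbR hQV2
  have hriemL := tendsto_riemann_clamp_sq ht i0 hXc hconv hXL
  have hriemR := tendsto_riemann_clamp_sq ht iN hXc hconv hXRt
  have hlim := ((hitoL.const_mul (2 * γ / bathAmp γ T_L)).sub (hriemL.const_mul (2 * γ ^ 2 / bathAmp γ T_L ^ 2))).add
    ((hitoR.const_mul (2 * γ / bathAmp γ T_R)).sub (hriemR.const_mul (2 * γ ^ 2 / bathAmp γ T_R ^ 2)))
  have hfun : (fun m : ℕ => logW ω₂ lam β γ N T_L T_R R t 1 1 m y w) = fun m =>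
      2 * γ / bathAmp γ T_L * itoPiece t R i0 z (bm1 w) m - 2 * γ ^ 2 / bathAmp γ T_L ^ 2 * riemPiece t R i0 z m +
      (2 * γ / bathAmp γ T_R * itoPiece t R iN z (bm2 w) m - 2 * γ ^ 2 / bathAmp γ T_R ^ 2 * riemPiece t R iN z m) := by
    funext m; exact logW_eq hω hl hβ hγ hN i0 iN hi0 hiN hTL hTR ht R y w 1 1 m
  rw [hfun]
  refine (hlim.congr fun m => rfl).trans ?_
  rw [integral_mul_drift_snd_eq ω₂ lam β γ N i0, integral_mul_drift_snd_eq ω₂ lam β γ N iN]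
  have hcL2 := bathAmp_sq hγ.le hTL.le
  have hcR2 := bathAmp_sq hγ.le hTR.le
  have hcL := (bathAmp_pos hγ hTL).ne'
  have hcR := (bathAmp_pos hγ hTR).ne'
  refine le_of_eq ?_
  congr 1
  simp only [heatFunctional, leftHeat, rightHeat, rawObs, hX]
  field_simp
  rw [hcL2, hcR2]
  ring

/-- **The log-density along the anti-damped schemes converges to `-W(Z) + 2γt`.** -/
theorem tendsto_logW_anti
    (hgood : ∀ s ∈ Icc 0 t, |(thetaRevPath ω₂ lam β γ N T_L T_R y w s).2 i0| ≤ R - 1 ∧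
      |(thetaRevPath ω₂ lam β γ N T_L T_R y w s).2 iN| ≤ R - 1)
    (hQV1 : Tendsto (fun m : ℕ => ∑ k ∈ range (2 ^ m),
      (bm1 w (((k : ℝ) + 1) * (t / 2 ^ m)) - bm1 w ((k : ℝ) * (t / 2 ^ m))) ^ 2) atTop (𝓝 t))
    (hQV2 : Tendsto (fun m : ℕ => ∑ k ∈ range (2 ^ m),
      (bm2 w (((k : ℝ) + 1) * (t / 2 ^ m)) - bm2 w ((k : ℝ) * (t / 2 ^ m))) ^ 2) atTop (𝓝 t)) :
    Tendsto (fun m : ℕ => logW ω₂ lam β γ N T_L T_R R t (-1) (-1) m y w) atTop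
      (𝓝 (-(heatFunctional T_L T_R i0 iN (rawObs (pinnedChain ω₂ lam β γ) N i0 iN ib t y
        (thetaRevPath ω₂ lam β γ N T_L T_R y w))) + 2 * γ * t)) := by
  set X := thetaRevPath ω₂ lam β γ N T_L T_R y w with hX
  set z : ℕ → ℝ → PhaseSpace N := fun m => schemePath ω₂ lam β γ N T_L T_R R t (-1) (-1) m y w with hz
  have hR1 : 1 ≤ R := by have := (abs_nonneg _).trans (hgood 0 ⟨le_rfl, ht.le⟩).1; linarith
  have hXc : Continuous X := continuous_thetaRevPath hω hl.le hβ.le hγ.le N T_L T_R y w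
  have hzc : ∀ m, Continuous (z m) := fun m =>
    continuous_schemePath hω hl.le hβ.le γ N T_L T_R R t (-1) (-1) m y w
  have hXR : ∀ s ∈ Icc 0 t, |leftMom N (X s)| ≤ R ∧ |rightMom N (X s)| ≤ R := fun s hs => by
    rw [leftMom_eq hN i0 hi0, rightMom_eq hN iN hiN]
    exact ⟨(hgood s hs).1.trans (by linarith), (hgood s hs).2.trans (by linarith)⟩
  have hconv : ∀ η : ℝ, 0 < η → ∀ᶠ m : ℕ in atTop, ∀ s ∈ Icc 0 t, ‖z m s - X s‖ ≤ η :=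
    tendsto_schemePath_anti hω hl.le hβ.le hγ.le N T_L T_R ht (by linarith) y w hXR
  have hXL : ∀ s ∈ Icc 0 t, |(X s).2 i0| ≤ R - 1 := fun s hs => (hgood s hs).1
  have hXRt : ∀ s ∈ Icc 0 t, |(X s).2 iN| ≤ R - 1 := fun s hs => (hgood s hs).2
  have hXeq : ∀ s ∈ Icc 0 t, X s = y + ((-1 : ℝ) • noiseImpulse N (bathAmp γ T_L) (bathAmp γ T_R) (bm1 w s, bm2 w s) -
      (-1 * γ) • ∫ u in (0 : ℝ)..s, frictionVec N (X u)) + ∫ u in (0 : ℝ)..s, (pinnedChain ω₂ lam β 0).drift N (X u) := by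
    intro s hs
    have h := thetaRevPath_integralEq hω hl.le hβ.le hγ.le N T_L T_R y w t s hs
    rw [chainPairNoise_eq] at h
    exact h
  have hY₀c := (frictionless hω hl.le hβ.le N).contDiff_drift.continuous
  have hXbL := snd_bath_of_integralEq hY₀c hXc hXeq i0 (bathWeight_left hN i0 hi0)
    (fun s => noiseImpulse_snd_left hN i0 hi0 _ _ _)
  have hXbR := snd_bath_of_integralEq hY₀c hXc hXeq iN (bathWeight_right hN iN hiN)
    (fun s => noiseImpulse_snd_right hN iN hiN _ _ _)
  have hitoL := tendsto_ito_clamp ht i0 hXc hconv hXL (continuous_bm1 w) (bm1_zero w)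
    (continuous_drift_snd hω hl.le hβ.le N i0) (ε := -1) (σ := -1) (γ := γ)
    (by rw [neg_one_mul, neg_ne_zero]; exact (bathAmp_pos hγ hTL).ne') y hzc
    (fun m k hk => by
      have h := dyadic_node_left (frictionless hω hl.le hβ.le N) rfl ht hN γ R (bathAmp γ T_L) (bathAmp γ T_R)
        (-1) (-1) y (fun m => incrs t m w) i0 hi0 m k hk
      rw [incrs_apply hk] at h
      exact h) hXbL hQV1
  have hitoR := tendsto_ito_clamp ht iN hXc hconv hXRt (continuous_bm2 w) (bm2_zero w)
    (continuous_drift_snd hω hl.le hβ.le N iN) (ε := -1) (σ := -1) (γ := γ)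
    (by rw [neg_one_mul, neg_ne_zero]; exact (bathAmp_pos hγ hTR).ne') y hzc
    (fun m k hk => by
      have h := dyadic_node_right (frictionless hω hl.le hβ.le N) rfl ht hN γ R (bathAmp γ T_L) (bathAmp γ T_R)
        (-1) (-1) y (fun m => incrs t m w) iN hiN m k hk
      rw [incrs_apply hk] at h
      exact h) hXbR hQV2
  have hriemL := tendsto_riemann_clamp_sq ht i0 hXc hconv hXL
  have hriemR := tendsto_riemann_clamp_sq ht iN hXc hconv hXRt
  have hlim := ((hitoL.const_mul (2 * γ / bathAmp γ T_L)).sub (hriemL.const_mul (2 * γ ^ 2 / bathAmp γ T_L ^ 2))).add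
    ((hitoR.const_mul (2 * γ / bathAmp γ T_R)).sub (hriemR.const_mul (2 * γ ^ 2 / bathAmp γ T_R ^ 2)))
  have hfun : (fun m : ℕ => logW ω₂ lam β γ N T_L T_R R t (-1) (-1) m y w) = fun m =>
      2 * γ / bathAmp γ T_L * itoPiece t R i0 z (bm1 w) m - 2 * γ ^ 2 / bathAmp γ T_L ^ 2 * riemPiece t R i0 z m +
      (2 * γ / bathAmp γ T_R * itoPiece t R iN z (bm2 w) m - 2 * γ ^ 2 / bathAmp γ T_R ^ 2 * riemPiece t R iN z m) := by
    funext m; exact logW_eq hω hl hβ hγ hN i0 iN hi0 hiN hTL hTR ht R y w (-1) (-1) m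
  rw [hfun]
  refine (hlim.congr fun m => rfl).trans ?_
  rw [integral_mul_drift_snd_eq ω₂ lam β γ N i0, integral_mul_drift_snd_eq ω₂ lam β γ N iN]
  have hcL2 := bathAmp_sq hγ.le hTL.le
  have hcR2 := bathAmp_sq hγ.le hTR.le
  have hcL := (bathAmp_pos hγ hTL).ne'
  have hcR := (bathAmp_pos hγ hTR).ne'
  refine le_of_eq ?_
  congr 1
  simp only [heatFunctional, leftHeat, rightHeat, rawObs, hX]
  field_simp
  rw [hcL2, hcR2]
  ring

end Main

/-! ### Convergence of the observables -/

/-- Time integrals of a continuous function along uniformly convergent continuous paths converge. -/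
theorem tendsto_intervalIntegral_of_unif {t : ℝ} (ht : 0 ≤ t) {z : ℕ → ℝ → PhaseSpace N} {X : ℝ → PhaseSpace N}
    (hXc : Continuous X) (hzc : ∀ m, Continuous (z m))
    (hconv : ∀ η : ℝ, 0 < η → ∀ᶠ m : ℕ in atTop, ∀ s ∈ Icc 0 t, ‖z m s - X s‖ ≤ η)
    {f : PhaseSpace N → ℝ} (hf : Continuous f) :
    Tendsto (fun m : ℕ => ∫ s in (0 : ℝ)..t, f (z m s)) atTop (𝓝 (∫ s in (0 : ℝ)..t, f (X s))) := by
  rw [Metric.tendsto_atTop]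
  intro η hη
  obtain ⟨ρ, hρ⟩ := isCompact_Icc.exists_bound_of_continuousOn (hXc.continuousOn (s := Icc 0 t))
  have huc := (isCompact_closedBall (0 : PhaseSpace N) (ρ + 1)).uniformContinuousOn_of_continuous hf.continuousOn
  rw [Metric.uniformContinuousOn_iff_le] at huc
  obtain ⟨θ, hθ0, hθ⟩ := huc (η / (2 * (t + 1))) (by positivity)
  obtain ⟨m₀, hm₀⟩ := eventually_atTop.1 (hconv (min 1 θ) (by positivity))
  refine ⟨m₀, fun m hm => ?_⟩
  have hclose := hm₀ m hm
  have hi1 : IntervalIntegrable (fun s => f (z m s)) volume 0 t := (hf.comp (hzc m)).intervalIntegrable 0 t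
  have hi2 : IntervalIntegrable (fun s => f (X s)) volume 0 t := (hf.comp hXc).intervalIntegrable 0 t
  rw [Real.dist_eq, ← intervalIntegral.integral_sub hi1 hi2]
  have hbound : ∀ s ∈ Set.uIoc (0 : ℝ) t, ‖f (z m s) - f (X s)‖ ≤ η / (2 * (t + 1)) := by
    intro s hs
    rw [uIoc_of_le ht] at hs
    have hs' : s ∈ Icc 0 t := ⟨hs.1.le, hs.2⟩
    have hXs : X s ∈ closedBall (0 : PhaseSpace N) (ρ + 1) := by
      rw [mem_closedBall, dist_zero_right]; linarith [hρ s hs']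
    have hzs : z m s ∈ closedBall (0 : PhaseSpace N) (ρ + 1) := by
      rw [mem_closedBall, dist_zero_right]
      calc ‖z m s‖ ≤ ‖z m s - X s‖ + ‖X s‖ := norm_le_norm_sub_add _ _
        _ ≤ 1 + ρ := add_le_add ((hclose s hs').trans (min_le_left _ _)) (hρ s hs')
        _ = ρ + 1 := add_comm _ _
    have := hθ _ hzs _ hXs (by rw [dist_eq_norm]; exact (hclose s hs').trans (min_le_right _ _))
    rwa [dist_eq_norm] at this
  calc |∫ s in (0 : ℝ)..t, f (z m s) - f (X s)| = ‖∫ s in (0 : ℝ)..t, f (z m s) - f (X s)‖ := (Real.norm_eq_abs _).symm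
    _ ≤ η / (2 * (t + 1)) * |t - 0| := intervalIntegral.norm_integral_le_of_norm_le_const hbound
    _ < η := by
        rw [sub_zero, abs_of_nonneg ht, div_mul_eq_mul_div, div_lt_iff₀ (by positivity)]
        nlinarith

/-- **The raw observables of uniformly convergent paths converge** (pinned chain; the integrands of
the work integrals and of the bond heat are continuous). -/
theorem tendsto_rawObs_of_unif (ω₂ lam β γ : ℝ) (i0 iN ib : Fin N) {t : ℝ} (ht : 0 ≤ t) (y : PhaseSpace N)
    {z : ℕ → ℝ → PhaseSpace N} {X : ℝ → PhaseSpace N} (hXc : Continuous X) (hzc : ∀ m, Continuous (z m))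
    (hconv : ∀ η : ℝ, 0 < η → ∀ᶠ m : ℕ in atTop, ∀ s ∈ Icc 0 t, ‖z m s - X s‖ ≤ η) :
    Tendsto (fun m : ℕ => rawObs (pinnedChain ω₂ lam β γ) N i0 iN ib t y (z m)) atTop
      (𝓝 (rawObs (pinnedChain ω₂ lam β γ) N i0 iN ib t y X)) := by
  have hend : Tendsto (fun m : ℕ => z m t) atTop (𝓝 (X t)) := by
    rw [Metric.tendsto_atTop]
    intro η hη
    obtain ⟨m₀, hm₀⟩ := eventually_atTop.1 (hconv (η / 2) (half_pos hη))
    exact ⟨m₀, fun m hm => by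
      rw [dist_eq_norm]; exact (hm₀ m hm t ⟨ht, le_rfl⟩).trans_lt (half_lt_self hη)⟩
  have hI : ∀ i : Fin N, Tendsto (fun m : ℕ => workIntegral (pinnedChain ω₂ lam β γ) N i t (z m)) atTop
      (𝓝 (workIntegral (pinnedChain ω₂ lam β γ) N i t X)) := fun i =>
    tendsto_intervalIntegral_of_unif ht hXc hzc hconv
      (((continuous_apply i).comp continuous_snd).mul (continuous_partialQ_pinned N ω₂ lam β γ i))
  have hQ : Tendsto (fun m : ℕ => bondHeat (pinnedChain ω₂ lam β γ) N ib t (z m)) atTop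
      (𝓝 (bondHeat (pinnedChain ω₂ lam β γ) N ib t X)) :=
    tendsto_intervalIntegral_of_unif ht hXc hzc hconv (continuous_bondCurrent_pinned N ω₂ lam β γ ib)
  exact tendsto_const_nhds.prodMk_nhds (hend.prodMk_nhds ((hI i0).prodMk_nhds ((hI iN).prodMk_nhds hQ)))

/-- **The raw observables of uniformly convergent paths converge** — `∀`-form registered as a sub-goal of the crux item. -/
theorem rawObs_tendsto_of_unif :
    ∀ (ω₂ lam β γ : ℝ) (N : ℕ) (i0 iN ib : Fin N) (t : ℝ), 0 ≤ t → ∀ (y : PhaseSpace N) (z : ℕ → ℝ → PhaseSpace N) (X : ℝ → PhaseSpace N), Continuous X → (∀ m, Continuous (z m)) → (∀ η : ℝ, 0 < η → ∀ᶠ m : ℕ in Filter.atTop, ∀ s ∈ Set.Icc 0 t, ‖z m s - X s‖ ≤ η) → Filter.Tendsto (fun m : ℕ => rawObs (pinnedChain ω₂ lam β γ) N i0 iN ib t y (z m)) Filter.atTop (nhds (rawObs (pinnedChain ω₂ lam β γ) N i0 iN ib t y X)) :=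
  fun ω₂ lam β γ _ i0 iN ib _ ht y _ _ hXc hzc hconv => tendsto_rawObs_of_unif ω₂ lam β γ i0 iN ib ht y hXc hzc hconv

end Summit.AtomisticToContinuum.FouriersLaw.Theorems.LinearResponseFTUR

end
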